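import Mathlib
import Summits.MatrixMultiplication.MatrixMultiplication.Theses.HiddenToeplitzCorners

/-!
# Stub `stub_corank_one_step` — corank-one step of the entangled adjugate kernel (`HiddenCorners`,
stmt-MatrixMultiplication-7492, line `birth`)

If a constant `K : ℂ^(r × r) → ℂ^N` is injective on pure tensors `v ⊗ w` (`v, w ≠ 0`) and
`T(X) · K · vec(adj X) = 0` for every singular `X`, then `det T(X) = 0` for every `X` of rank exactly
`r - 1`.  On that stratum the adjugate is a nonzero pure tensor: writing `X = P · diagonal D · Q` with
`P`, `Q` products of transvections (`det = 1`) and `D` having exactly one zero entry `D i₀ = 0`, one gets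
`adj X = adj Q · diagonal (Pi.single i₀ c) · adj P` with `c = ∏_{j ≠ i₀} D j ≠ 0`, i.e.
`adj X = v wᵀ` with `v` the `i₀`-th column of `adj Q` and `w` the `i₀`-th row of `c • adj P`, both
nonzero because `adj P`, `adj Q` have determinant `1`.  Hence `K · vec(adj X) ≠ 0` is a kernel vector of
`T(X)` (note `det X = 0` since `rank X < r`), and `det T(X) = 0` by `Matrix.exists_mulVec_eq_zero_iff`.
-/

set_option linter.dupNamespace false

namespace Summit.MatrixMultiplication.MatrixMultiplication.Cruxes.HiddenCorners.Birth

open Summit.MatrixMultiplication.MatrixMultiplication.Theses.HiddenToeplitzCorners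
open scoped BigOperators Matrix

/-- A square matrix of rank `< r` is singular: `rank X + 1 = r` forces `det X = 0` (an invertible
matrix has full rank `r`, `Matrix.rank_of_isUnit`). -/
private theorem det_eq_zero_of_rank_succ {r : ℕ} (X : Matrix (Fin r) (Fin r) ℂ)
    (hX : X.rank + 1 = r) : X.det = 0 := by
  by_contra hdet
  have hU : IsUnit X := (Matrix.isUnit_iff_isUnit_det X).mpr (isUnit_iff_ne_zero.mpr hdet)
  have h := Matrix.rank_of_isUnit X hU
  rw [Fintype.card_fin] at h
  omega

/-- The adjugate of a diagonal matrix `diagonal D` whose only zero entry is `D i₀` is the scaled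
elementary matrix `diagonal (Pi.single i₀ (∏_{j ≠ i₀} D j))`. -/
private theorem adjugate_diagonal_of_unique_zero {r : ℕ} (D : Fin r → ℂ) (i₀ : Fin r)
    (hD0 : D i₀ = 0) :
    (Matrix.diagonal D).adjugate =
      Matrix.diagonal (Pi.single i₀ (∏ j ∈ Finset.univ.erase i₀, D j)) := by
  rw [Matrix.adjugate_diagonal]
  congr 1
  funext i
  by_cases hi : i = i₀
  · subst hi
    rw [Pi.single_eq_same]
  · rw [Pi.single_eq_of_ne hi]
    exact Finset.prod_eq_zero (Finset.mem_erase.mpr ⟨Ne.symm hi, Finset.mem_univ _⟩) hD0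

/-- **On the corank-one stratum the adjugate is a nonzero pure tensor**: if `rank X + 1 = r` then
`adj X = v wᵀ` (`Matrix.vecMulVec v w`) for some `v ≠ 0`, `w ≠ 0`.  Proof through the transvection
normal form `X = P · diagonal D · Q` (`Matrix.Pivot.exists_list_transvec_mul_diagonal_mul_list_transvec`;
normal-form idiom as in `Literature/LinearAlgebra/Matrix/AdjugateKernelLine.lean`): `rank X = r - 1`
leaves exactly one zero on the diagonal `D`, and `adj` is anti-multiplicative. -/
private theorem adjugate_eq_vecMulVec_of_rank_succ {r : ℕ} (X : Matrix (Fin r) (Fin r) ℂ)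
    (hX : X.rank + 1 = r) :
    ∃ v w : Fin r → ℂ, v ≠ 0 ∧ w ≠ 0 ∧ X.adjugate = Matrix.vecMulVec v w := by
  classical
  obtain ⟨L, L', D, hXD⟩ := Matrix.Pivot.exists_list_transvec_mul_diagonal_mul_list_transvec X
  set P : Matrix (Fin r) (Fin r) ℂ := (L.map Matrix.TransvectionStruct.toMatrix).prod with hP
  set Q : Matrix (Fin r) (Fin r) ℂ := (L'.map Matrix.TransvectionStruct.toMatrix).prod with hQ
  have hPdet : P.det = 1 := Matrix.TransvectionStruct.det_toMatrix_prod L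
  have hQdet : Q.det = 1 := Matrix.TransvectionStruct.det_toMatrix_prod L'
  -- the diagonal part has rank `r - 1`, i.e. exactly one zero entry
  have hrankD : Fintype.card {i // D i ≠ 0} + 1 = r := by
    have h1 : X.rank = (Matrix.diagonal D).rank := by
      rw [hXD, Matrix.rank_mul_eq_left_of_isUnit_det Q _ (by rw [hQdet]; exact isUnit_one),
        Matrix.rank_mul_eq_right_of_isUnit_det P _ (by rw [hPdet]; exact isUnit_one)]
    rw [← Matrix.rank_diagonal, ← h1]
    exact hX
  have hcard : Fintype.card {i // ¬(D i ≠ 0)} = 1 := by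
    rw [Fintype.card_subtype_compl, Fintype.card_fin]
    omega
  obtain ⟨⟨i₀, hi₀⟩, huniq⟩ := Fintype.card_eq_one_iff.mp hcard
  have hD0 : D i₀ = 0 := not_not.mp hi₀
  have hDne : ∀ j, j ≠ i₀ → D j ≠ 0 := by
    intro j hj hDj
    exact hj (congrArg Subtype.val (huniq ⟨j, not_not.mpr hDj⟩))
  -- the adjugate of the diagonal part is `c • E_{i₀ i₀}` with `c ≠ 0`
  set c : ℂ := ∏ j ∈ Finset.univ.erase i₀, D j with hc
  have hcne : c ≠ 0 :=
    Finset.prod_ne_zero_iff.mpr fun j hj => hDne j (Finset.ne_of_mem_erase hj)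
  have hadjD : (Matrix.diagonal D).adjugate = Matrix.diagonal (Pi.single i₀ c) :=
    adjugate_diagonal_of_unique_zero D i₀ hD0
  refine ⟨fun a => Q.adjugate a i₀, fun b => c * P.adjugate i₀ b, ?_, ?_, ?_⟩
  · -- `v ≠ 0`: it is the `i₀`-th column of `adj Q`, and `det (adj Q) = 1`
    intro hv
    have h1 : Q.adjugate.det = 1 := by rw [Matrix.det_adjugate, hQdet, one_pow]
    have h2 : Q.adjugate.det = 0 :=
      Matrix.det_eq_zero_of_column_eq_zero i₀ fun a => congrFun hv a
    rw [h2] at h1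
    exact zero_ne_one h1
  · -- `w ≠ 0`: `c ≠ 0` and the `i₀`-th row of `adj P` is nonzero since `det (adj P) = 1`
    intro hw
    have h1 : P.adjugate.det = 1 := by rw [Matrix.det_adjugate, hPdet, one_pow]
    have h2 : P.adjugate.det = 0 :=
      Matrix.det_eq_zero_of_row_eq_zero i₀ fun b =>
        (mul_eq_zero.mp (congrFun hw b)).resolve_left hcne
    rw [h2] at h1
    exact zero_ne_one h1
  · -- `adj X = adj Q · diagonal (Pi.single i₀ c) · adj P = v wᵀ`
    rw [hXD, Matrix.adjugate_mul_distrib, Matrix.adjugate_mul_distrib, hadjD]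
    ext a b
    rw [Matrix.vecMulVec_apply, Matrix.mul_apply, Finset.sum_eq_single i₀]
    · rw [Matrix.diagonal_mul, Pi.single_eq_same]
    · intro k _ hk
      rw [Matrix.diagonal_mul, Pi.single_eq_of_ne hk, zero_mul, mul_zero]
    · intro h
      exact absurd (Finset.mem_univ i₀) h

/-- **STUB 1 — corank-one step of the adjugate corner criterion.**  If `K` is injective on the Segre
cone and `T(X) · (K · vec(adj X)) = 0` for every singular `X`, then `det T(X) = 0` for every `X` of
rank exactly `r - 1`: there `adj X = v wᵀ ≠ 0` (`adjugate_eq_vecMulVec_of_rank_succ`), so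
`K · vec(adj X) ≠ 0` is a kernel vector of `T(X)` (`det X = 0` as `rank X < r`), whence
`det T(X) = 0` by `Matrix.exists_mulVec_eq_zero_iff`. -/
theorem stub_corank_one_step :
    ∀ (r N : ℕ) (T : Fin r → Fin r → Matrix (Fin N) (Fin N) ℂ) (K : Matrix (Fin N) (Fin r × Fin r) ℂ),
      (∀ v w : Fin r → ℂ, v ≠ 0 → w ≠ 0 →
        Matrix.mulVec K (fun p : Fin r × Fin r => v p.1 * w p.2) ≠ 0) →
      (∀ X : Matrix (Fin r) (Fin r) ℂ, X.det = 0 →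
        Matrix.mulVec (∑ a : Fin r, ∑ b : Fin r, X a b • T a b)
          (Matrix.mulVec K fun p : Fin r × Fin r => X.adjugate p.1 p.2) = 0) →
      ∀ X : Matrix (Fin r) (Fin r) ℂ, X.rank + 1 = r →
        (∑ a : Fin r, ∑ b : Fin r, X a b • T a b).det = 0 := by
  intro r N T K hK hker X hX
  obtain ⟨v, w, hv, hw, hadj⟩ := adjugate_eq_vecMulVec_of_rank_succ X hX
  have h1 := hker X (det_eq_zero_of_rank_succ X hX)
  have h2 : (fun p : Fin r × Fin r => X.adjugate p.1 p.2) = fun p => v p.1 * w p.2 := by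
    funext p
    rw [hadj, Matrix.vecMulVec_apply]
  rw [h2] at h1
  exact Matrix.exists_mulVec_eq_zero_iff.mp ⟨_, hK v w hv hw, h1⟩

end Summit.MatrixMultiplication.MatrixMultiplication.Cruxes.HiddenCorners.Birth
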